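import Mathlib
import Summits.Ventures.PercRepro2.TypedSplit
import Summits.Ventures.PercRepro2.HCovTyped

/-!
# Type `2` dominates contraction: the candidate row (T23) and the reduction of row 2′TRI to its
type-`1`-only instances (blind cell PercRepro2, night-3 g6, 2026-08-25)

For the kernel `K₃` of (HCOV) and a typed instance `(F, z, τ)`, the four typed bases at an edge
`e ∈ F` — `N_{τ[e:=k]}`, `k = 0, 1, 2, 3` — are the Bernstein coefficients of the weight `p_e`
(`τ e = 3` is `e` pinned open = contracted, `typedCount_type_three`). The CANDIDATE ROW

  (T23)  `N_{τ[e:=2]} ≥ N_{τ[e:=3]}`   at EVERY typed edge of every instance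

(census: 0 violations on every typed graph on the five marks with `≤ 10` edges, with one extra
unmarked vertex `≤ 10` edges, every edge, every type vector — night-3 g6, `proofs/NIGHT3-CERT.md`
§15.5; equivalently `Gc′(p_e = 1) ≤ 2·Gc(p_e = 1)`; it contains the pendant-`a₃` row (PM) of
`TypedPendantA3.lean` as the special case of a leaf edge at `a₃`, and it is asymptotically tight on
the cell's hub family `H_k`, where `N₂ − N₃ = 8` while `N₃ = 4k`) is stated here as the Prop `T23`
and shown to REDUCE row 2′TRI to its TYPE-`1`-ONLY instances:

* **`typedCount_nonneg_of_T23_of_typeOne`**: if (T23) holds and every base whose typed edges are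
  all of type `1` (every typed edge open in exactly one copy — the three copies are edge-disjoint)
  is nonnegative, then every typed base with types in `{1, 2}` is nonnegative — by induction on
  the number of typed edges, contracting one type-`2` edge at a time.
-/

namespace Summit.Ventures.PercRepro2

namespace CovForm

namespace TypedRed

variable {V : Type*} {E : Type*} [Fintype E] [DecidableEq E] {R : Type*} [Field R]
  [LinearOrder R] [IsStrictOrderedRing R]
variable (ends : E → Sym2 V) (o a₁ a₂ a₃ b : V)

/-- **The candidate row (T23) for the given graph and marking** (NOT a theorem): at every typed edge
`e` of type `2`, the typed base dominates the base with `e` pinned open. -/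
def T23 : Prop :=
  ∀ (F : Finset E) (z : Config E) (τ : E → ℕ), (∀ e ∈ F, τ e = 1 ∨ τ e = 2) →
    ∀ e ∈ F, τ e = 2 →
      typedCount F z (Function.update τ e 3)
          (K3 ends o a₁ a₂ a₃ b : Config E → Config E → Config E → R) ≤
        typedCount F z τ (K3 ends o a₁ a₂ a₃ b)

/-- **Row 2′TRI on the type-`1`-only instances** of the given graph and marking: every typed edge
open in exactly one copy. -/
def TriTypeOne : Prop :=
  ∀ (F : Finset E) (z : Config E) (τ : E → ℕ), (∀ e ∈ F, τ e = 1) →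
    0 ≤ typedCount F z τ (K3 ends o a₁ a₂ a₃ b : Config E → Config E → Config E → R)

omit [IsStrictOrderedRing R] in
/-- **(T23) reduces row 2′TRI to its type-`1`-only instances**: by induction on the number of typed
edges — a type-`2` edge is contracted (`typedCount_type_three`: one typed edge fewer, the pinning
opened at `e`) and (T23) pays the difference; when no type-`2` edge is left the instance is
type-`1`-only. -/
theorem typedCount_nonneg_of_T23_of_typeOne (h23 : T23 ends o a₁ a₂ a₃ b (R := R))
    (h1 : TriTypeOne ends o a₁ a₂ a₃ b (R := R)) (F : Finset E) (z : Config E) (τ : E → ℕ)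
    (hτ : ∀ e ∈ F, τ e = 1 ∨ τ e = 2) :
    0 ≤ typedCount F z τ (K3 ends o a₁ a₂ a₃ b : Config E → Config E → Config E → R) := by
  induction F using Finset.strongInduction generalizing z τ with
  | H F ih =>
    by_cases hall : ∀ e ∈ F, τ e = 1
    · exact h1 F z τ hall
    · obtain ⟨e, heF, hne⟩ : ∃ e ∈ F, τ e ≠ 1 := by
        by_contra hc
        exact hall fun e he => by_contra fun h => hc ⟨e, he, h⟩
      have h2 : τ e = 2 := (hτ e heF).resolve_left hne
      refine le_trans ?_ (h23 F z τ hτ e heF h2)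
      rw [typedCount_type_three F e heF z _ (Function.update_self e 3 τ)]
      refine ih (F.erase e) (Finset.erase_ssubset heF) (Function.update z e true)
        (Function.update τ e 3) fun e' he' => ?_
      rw [Function.update_of_ne (Finset.ne_of_mem_erase he')]
      exact hτ e' (Finset.mem_of_mem_erase he')

end TypedRed

end CovForm

end Summit.Ventures.PercRepro2
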